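import Summits.BirchSwinnertonDyer.BirchSwinnertonDyer.Theorems.AdditiveBranchIMCGordTwoRankOneTameRowSchneiderFreeBSDp
import Summits.BirchSwinnertonDyer.BirchSwinnertonDyer.Theorems.AdditiveBranchIMCGordTwoRankOneTwistRowClosedHL
import HarnessLib

/-!
# Line `wan_tame_bdp_road` (crux `GordTwoRankOne`, stmt-BirchSwinnertonDyer-19358) — THE RANK-ONE BOOKING DOOR WIDENED AGAIN: `BSD(E,p)` on the
# DYADIC twist-type rank-one row (every additive prime — `2` included — of quadratic-twist type) from the same thirteen printed names
# (LEAD cruxlead-19357 g14, for the pen and the booking desk)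

Sequel of `AdditiveBranchIMCGordTwoRankOneTwistOddRowBSDp.lean` (p756120, LEAD g13: the door on the odd-twist-type rank-one row, «no additive
reduction above `2`»). Its upper half `TameRowRankOneBSDp.missingUpperBoundAt_rankOne_of_cellGordTwo` is ROW-GENERIC (LEAD g12); its lower half
is now available on the DYADIC row (`TwistRowRankOneClosedHL.missingLowerBoundAt_rankOne_of_twistAny_tenFacts`, LEAD g14: `p ≥ 5`, `ρ̄` onto,
every additive prime of quadratic-twist type — at `2`: `E^{(t)}` not additive for some `t ∈ {−1, 2, −2}` —, a Wan prime; the Castella–Liu–Wan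
pair in the DYADIC semistable-twist reading). Hence:

* `bsdp_rankOne_of_twistRow_thirteenFacts` — `BSD(E,p)` on the dyadic twist-type rank-one row from the thirteen names.

Decidable binders for the desk: `r_an = 1`; `CellGordTwo`; `5 ≤ p`; `Surj`; «at `2`: `E` semistable, or `E ⊗ χ` semistable for
`χ ∈ {χ_{−4}, χ_8, χ_{−8}}`»; «at every odd additive prime `ℓ`, `E^{(ℓ*)}` not additive»; a Wan prime; `p ∤ ∏ c_ℓ`. THEOREMS ONLY; nothing is
booked by this file; crux 19358 stays OPEN; BSD is proved for no curve beyond print by any of this.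
References: [Kato2004Asterisque] Thm. 17.4 (3); [Delbourgo1998] Prop. 4; [HoffsteinLuo1997] Theorem (§1); [CastellaLiuWan2022] Thm. 8.2.1;
[SkinnerUrban2014] Thm. 2 (a); [AtkinLi1978] §1, §3.
-/

set_option linter.dupNamespace false
set_option autoImplicit false

noncomputable section

open scoped Classical

open NumberField IsDedekindDomain IsDedekindDomain.HeightOneSpectrum Rat.HeightOneSpectrum
open WeierstrassCurve Literature.NumberTheory.EllipticCurves
  Literature.NumberTheory.EllipticCurves.ModularForms
  Literature.NumberTheory.EllipticCurves.Rank1Residual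
  Literature.NumberTheory.EllipticCurves.Rank1Residual.Typed

open Summit.BirchSwinnertonDyer.Rank1Residual
open Summit.BirchSwinnertonDyer.Rank1Residual.Additive
open Summit.BirchSwinnertonDyer.BirchSwinnertonDyer.Theorems
open ThreeFieldRoadSupply
open Summit.BirchSwinnertonDyer.BirchSwinnertonDyer.Theses.AdditiveBranchIMC

namespace Summit.BirchSwinnertonDyer.BirchSwinnertonDyer.Theorems.TwistRowRankOneBSDp

/-- **`BSD(E,p)` ON THE RANK-ONE DYADIC TWIST-TYPE ROW FROM THIRTEEN PRINTED THEOREMS BY NAME** (p750714 / p756120 widened with the line): for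
every globally minimal `E/ℚ` of analytic rank `1` and every prime `p` with `(E, p)` on cell (G-ord, `e = 2`), `p ≥ 5`, `ρ̄_{E,p}` onto, EVERY
additive prime — `2` included — of quadratic-twist type, a Wan prime `q` and `p ∤ ∏ c_ℓ(E)`: `BSDp W p`, GIVEN Kato/Wuthrich's
cyclotomic half at a surjective prime, Delbourgo 1998 Prop. 4, GZK, a modular parametrisation, Hoffstein–Luo 1997, Cai–Shu–Tian 2014 Thm. 1.1
(ring class), Hsieh 2014 Thm. B, Liu–Zhang–Zhang 2018, Castella–Liu–Wan 2022 Thm. 8.2.1 and §6.1 (DYADIC semistable-twist reading), Skinner–Urban 2014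
Thm. 2 (a), Mazur 1978 Cor. 4.1, the Eichler–Shimura relation. Lower half: `TwistRowRankOneClosedHL.missingLowerBoundAt_rankOne_of_twistAny_tenFacts`;
upper half: `TameRowRankOneBSDp.missingUpperBoundAt_rankOne_of_cellGordTwo` (row-generic); glue `bsdp_of_missingPPartAt` ∘ `missingPPartAt_of_lower_of_upper`.
[cite: Kato2004Asterisque, Thm. 17.4 (3) (p. 273)] [cite: Delbourgo1998, Prop. 4 (p. 144)] [cite: SkinnerUrban2014, Thm. 2 (a)]
[cite: CastellaLiuWan2022, Thm. 8.2.1 (p. 85) (Forum Math. Sigma 10 (2022) e110)] [cite: HoffsteinLuo1997, Theorem (§1, pp. 435–436)] -/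
theorem bsdp_rankOne_of_twistRow_thirteenFacts
    (hWu : Wuthrich2014.kato_halfEigenCharIdeal_dvd_cyclotomicPrime_of_surjective)
    (hDel : Delbourgo1998.prop4_rankZero_pow_dvd_constantCoeff)
    (hGZK : rank_eq_analyticRank_of_analyticRank_le_one) (hmodP : nonempty_modularParametrizationData)
    (hHL : HoffsteinLuo1997_exists_twist_L_one_ne_zero) (hCSTrc : CaiShuTian2014.thm11_ringClassChar)
    (hB : Hsieh2014.thmB_exists_isHsiehLFunction_coeff_norm_eq_one_unrPeriod_ramifiedSteinberg)
    (hLZZ : LiuZhangZhang2018.thm151_thm153_modularCurve_heegnerVector_additive_ramifiedSteinberg)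
    (h821 : CastellaLiuWan2022.thm821_XGr₂_charIdeal_mul_le_awayFromCyc_semistableTwistDyadic)
    (h61 : CastellaLiuWan2022.sec61_exists_isCastellaLiuWanLFunction₂_semistableTwistDyadic)
    (hSU : padicValRat_bsd_rank_zero) (hMaz : mazur_not_dvd_maninConstant_of_odd)
    (hES : ModularForms.eichlerShimuraRelation_heckeNeighbour)
    (W : WeierstrassCurve ℚ) [W.IsElliptic] [W.IsGloballyMinimal] (p : ℕ) [Fact p.Prime]
    (hr : W.analyticRank = 1) (hcell : N10.CellGordTwo W p) (hp5 : 5 ≤ p) (hsurj : Surj W p)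
    (h2tt : ∀ r : Nat.Primes, (r : ℕ) = 2 → W.HasAdditiveReductionAt ((primesEquiv (R := ℤ)).symm r) →
      ∃ t : ℤ, (t = -1 ∨ t = 2 ∨ t = -2) ∧ ¬ (W.quadraticTwist (t : ℚ)).HasAdditiveReductionAt ((primesEquiv (R := ℤ)).symm r))
    (htt : ∀ r : Nat.Primes, (r : ℕ) ≠ 2 → W.HasAdditiveReductionAt ((primesEquiv (R := ℤ)).symm r) →
      ¬ (W.quadraticTwist (((-1 : ℤ) ^ ((r : ℕ) / 2) * r : ℤ) : ℚ)).HasAdditiveReductionAt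
        ((primesEquiv (R := ℤ)).symm r))
    {q : ℕ} [Fact q.Prime] (hWan : WanPrime W p q) (htam : ¬ p ∣ W.tamagawaProduct) : BSDp W p :=
  bsdp_of_missingPPartAt W p hGZK (by omega)
    (missingPPartAt_of_lower_of_upper W p
      (TwistRowRankOneClosedHL.missingLowerBoundAt_rankOne_of_twistAny_tenFacts hWu hDel hGZK hmodP hHL hCSTrc hB hLZZ h821 h61
        W p hr hcell hp5 hsurj h2tt htt hWan)
      (TameRowRankOneBSDp.missingUpperBoundAt_rankOne_of_cellGordTwo hGZK hmodP hSU hCSTrc hMaz hHL hES W p hp5 hr hcell hsurj htam hWan.1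
        hWan.2.2.1 hWan.2.2.2.2))

end Summit.BirchSwinnertonDyer.BirchSwinnertonDyer.Theorems.TwistRowRankOneBSDp

end
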